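import Mathlib.AlgebraicGeometry.Pullbacks
import HarnessLib

/-!
# Crux `NoZenoR` (stmt-ResolutionOfSingularities-19943), β layer, `stub_L1wCoreF` descent brick for BC-4b hypothesis (T):
# AUTOMORPHISMS OF THE BASE LIFT TO AUTOMORPHISMS OF THE BASE CHANGE

Route `ResolutionOfSingularities/HomologicalConductor`, crux chain W4.4.  OURS (cell res-hironaka, seat res-L0-w44-stub-2,
(L1)-PREP v4 §2 / planner (ρ48): the stabiliser `H` of `𝔫` acts on `Ŝ` by `S`-algebra automorphisms, hence on
`X_B = X ×_S Spec Ŝ` over `X`); AI-written, weaker than expert review; nothing here is a statement of the manuscript under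
review (Hironaka 2017).  Def-free, fact-free, `--supports 19943 --as helper`.

For a cartesian square `σ : X_B → X`, `π_B : X_B → Spec Ŝ` over `π : X → Spec S` and `Spec Ŝ → Spec S`, every
`S`-algebra automorphism `θ` of `Ŝ` lifts to an automorphism `e_θ` of `X_B` with `e_θ ≫ σ = σ` and
`e_θ ≫ π_B = π_B ≫ Spec θ` — the shape of the witnesses of hypothesis `hsymm` of
`…NoZenoGaloisAscent.isMinimalResolution_of_flat_of_symmetric`.  What remains for (T) after this file is only the
TRANSITIVITY of these `e_θ` (θ ∈ H) on the points over each exceptional generic point.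

* `specMap_algEquiv_comp` — `Spec θ ≫ (Spec Ŝ → Spec S) = (Spec Ŝ → Spec S)`;
* **`exists_iso_baseChange_of_algEquiv`** — the lift `e_θ : X_B ≅ X_B` with `e_θ.hom ≫ σ = σ`,
  `e_θ.hom ≫ π_B = π_B ≫ Spec θ`.

References (context): A. Grothendieck, EGA I (1971) §3.3 (functoriality of fibre products) [folklore].
-/

noncomputable section

-- single-problem summit: the doubled namespace component `ResolutionOfSingularities` is forced
set_option linter.dupNamespace false

namespace Summit.ResolutionOfSingularities.ResolutionOfSingularities.Theorems.NoZeno.ExcCount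

open CategoryTheory AlgebraicGeometry Limits

universe u

variable {S Ŝ : Type u} [CommRing S] [CommRing Ŝ] [Algebra S Ŝ]
  {X XB : Scheme.{u}} (π : X ⟶ Spec (.of S)) (πB : XB ⟶ Spec (.of Ŝ)) (σ : XB ⟶ X)
  (H : IsPullback σ πB π (Spec.map (CommRingCat.ofHom (algebraMap S Ŝ))))

/-- `Spec` of an `S`-algebra automorphism of `Ŝ` is an automorphism of `Spec Ŝ` OVER `Spec S`. [folklore] -/
theorem specMap_algEquiv_comp (θ : Ŝ ≃ₐ[S] Ŝ) :
    Spec.map (CommRingCat.ofHom θ.toRingEquiv.toRingHom) ≫ Spec.map (CommRingCat.ofHom (algebraMap S Ŝ)) =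
      Spec.map (CommRingCat.ofHom (algebraMap S Ŝ)) := by
  rw [← Spec.map_comp, ← CommRingCat.ofHom_comp]
  congr 2
  ext s
  exact θ.commutes s

include H in
/-- **`S`-algebra automorphisms of `Ŝ` lift to automorphisms of `X_B = X ×_S Spec Ŝ` over `X`**: for `θ : Ŝ ≃ₐ[S] Ŝ`
there is `e_θ : X_B ≅ X_B` with `e_θ.hom ≫ σ = σ` and `e_θ.hom ≫ π_B = π_B ≫ Spec θ` (universal property of the
cartesian square; the inverse is the lift of `θ⁻¹`). [folklore] -/
theorem exists_iso_baseChange_of_algEquiv (θ : Ŝ ≃ₐ[S] Ŝ) :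
    ∃ e : XB ≅ XB, e.hom ≫ σ = σ ∧
      e.hom ≫ πB = πB ≫ Spec.map (CommRingCat.ofHom θ.toRingEquiv.toRingHom) := by
  -- the lifts of `θ` and `θ⁻¹`
  have w : ∀ (τ : Ŝ ≃ₐ[S] Ŝ), σ ≫ π =
      (πB ≫ Spec.map (CommRingCat.ofHom τ.toRingEquiv.toRingHom)) ≫
        Spec.map (CommRingCat.ofHom (algebraMap S Ŝ)) := fun τ => by
    rw [Category.assoc, specMap_algEquiv_comp, H.w]
  let f : XB ⟶ XB := H.lift σ (πB ≫ Spec.map (CommRingCat.ofHom θ.toRingEquiv.toRingHom)) (w θ)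
  let f' : XB ⟶ XB := H.lift σ (πB ≫ Spec.map (CommRingCat.ofHom θ.symm.toRingEquiv.toRingHom)) (w θ.symm)
  have hfσ : f ≫ σ = σ := H.lift_fst _ _ _
  have hfπ : f ≫ πB = πB ≫ Spec.map (CommRingCat.ofHom θ.toRingEquiv.toRingHom) := H.lift_snd _ _ _
  have hf'σ : f' ≫ σ = σ := H.lift_fst _ _ _
  have hf'π : f' ≫ πB = πB ≫ Spec.map (CommRingCat.ofHom θ.symm.toRingEquiv.toRingHom) := H.lift_snd _ _ _
  -- `Spec θ⁻¹ ≫ Spec θ = 𝟙` and conversely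
  have hθθ' : Spec.map (CommRingCat.ofHom θ.toRingEquiv.toRingHom) ≫
      Spec.map (CommRingCat.ofHom θ.symm.toRingEquiv.toRingHom) = 𝟙 _ := by
    rw [← Spec.map_comp, ← CommRingCat.ofHom_comp]
    have : θ.toRingEquiv.toRingHom.comp θ.symm.toRingEquiv.toRingHom = RingHom.id Ŝ := by
      ext s; exact θ.apply_symm_apply s
    rw [this, CommRingCat.ofHom_id, Spec.map_id]
  have hθ'θ : Spec.map (CommRingCat.ofHom θ.symm.toRingEquiv.toRingHom) ≫
      Spec.map (CommRingCat.ofHom θ.toRingEquiv.toRingHom) = 𝟙 _ := by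
    rw [← Spec.map_comp, ← CommRingCat.ofHom_comp]
    have : θ.symm.toRingEquiv.toRingHom.comp θ.toRingEquiv.toRingHom = RingHom.id Ŝ := by
      ext s; exact θ.symm_apply_apply s
    rw [this, CommRingCat.ofHom_id, Spec.map_id]
  have h1 : f ≫ f' = 𝟙 XB := by
    apply H.hom_ext
    · rw [Category.assoc, hf'σ, hfσ, Category.id_comp]
    · rw [Category.assoc, hf'π, ← Category.assoc, hfπ, Category.assoc, hθθ', Category.comp_id, Category.id_comp]
  have h2 : f' ≫ f = 𝟙 XB := by
    apply H.hom_ext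
    · rw [Category.assoc, hfσ, hf'σ, Category.id_comp]
    · rw [Category.assoc, hfπ, ← Category.assoc, hf'π, Category.assoc, hθ'θ, Category.comp_id, Category.id_comp]
  exact ⟨⟨f, f', h1, h2⟩, hfσ, hfπ⟩

end Summit.ResolutionOfSingularities.ResolutionOfSingularities.Theorems.NoZeno.ExcCount

end
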